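import Mathlib.LinearAlgebra.Matrix.Transvection
import Mathlib.LinearAlgebra.Trace
import Mathlib.LinearAlgebra.Dual.Lemmas
import HarnessLib

/-!
# Goursat–Kolchin–Ribet, last step: an equivariant `Ad(A)` (resp. `Ad(A) ∘ dual`) between two factors is a
# twist `ρᵢ ≅ χ ⊗ ρⱼ` (resp. `ρᵢ^∨ ≅ χ ⊗ ρⱼ`) — Schur's lemma for the traceless commutant (Katz 1990,
# proof of Prop. 1.8.2, last paragraph)

Layer `Literature/AlgebraicGeometry/HodgeTheory` (companion of `GoursatKolchinRibetCriterion` /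
`GoursatKolchinRibetKernels`). THEOREMS only, pure linear algebra over any field. In Katz's proof, once Goursat's
lemma and `Aut 𝔰𝔩ₙ` have produced a linear isomorphism `A : Vᵢ ≅ Vⱼ` (resp. `A : Vᵢ^∨ ≅ Vⱼ`) such that
`X ↦ A X A⁻¹` (resp. `X ↦ A X^∨ A⁻¹`) intertwines the conjugation actions of every `g ∈ G` on the traceless
endomorphisms of `Vᵢ` and `Vⱼ`, one concludes (p. 32 L8–12: "`g ↦ AgA⁻¹` … `ρᵢ ≅ χ ⊗ ρⱼ`") that `A gᵢ = χ(g) gⱼ A`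
for a scalar `χ(g)`: the element `A⁻¹ gⱼ⁻¹ A gᵢ` commutes with every traceless endomorphism, hence is scalar.
This file proves exactly that step, in the shape of hypotheses (3)/(4) of
`Katz1990_goursatKolchinRibet_specialLinear'`:

* `exists_eq_smul_id_of_forall_comm_of_trace_eq_zero` — **Schur for the traceless commutant**: an endomorphism
  commuting with every traceless endomorphism of a finite-dimensional space is a scalar (it commutes with the
  elementary matrices `E_{kl}`, `k ≠ l`; Mathlib `Matrix.mem_range_scalar_of_commute_single`).
* `exists_comp_eq_smul_comp_of_conj_equivariant` — if `A (s X s⁻¹) A⁻¹ = s' (A X A⁻¹) s'⁻¹` for all traceless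
  `X`, then `A ∘ s = c • (s' ∘ A)` (the twist (3)).
* `exists_comp_dualMap_eq_smul_comp_of_conj_equivariant` — the contragredient version with
  `A : V^∨ ≅ V'`: if `A (s X s⁻¹)^∨ A⁻¹ = s' (A X^∨ A⁻¹) s'⁻¹` for all traceless `X`, then
  `A ∘ (s⁻¹)^∨ = c • (s' ∘ A)` (the twist (4), `(ρᵢ)^∨(g) = (gᵢ⁻¹)^∨`).
Written by the prover seat `hodge-nonav-prover-Ax` (cell `hodge-nonav`) as step C6 of the roadmap
`memos/GKR-CORE-ROADMAP-Ax-g2.md` for crux K1 of `Summits/HodgeConjecture/HodgeConjecture/Theses/CyclicUnitaryPowers.lean`.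

## References
* [Katz1990ESDE] N. M. Katz, *Exponential Sums and Differential Equations* (1990), §1.8, proof of Prop. 1.8.2
  (last paragraph: adaptedness turns the graph into `g ↦ AgA⁻¹` or `g ↦ Ag^{−t}A⁻¹`, i.e. `ρᵢ ≅ χ ⊗ ρⱼ` or
  `ρᵢ^∨ ≅ χ ⊗ ρⱼ`).
-/

noncomputable section

open Module

namespace Literature.AlgebraicGeometry.HodgeTheory

universe u v v'

variable {K : Type u} [Field K] {V : Type v} [AddCommGroup V] [Module K V] [FiniteDimensional K V]
  {V' : Type v'} [AddCommGroup V'] [Module K V']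

/-! ### §1 Schur's lemma for the traceless commutant -/

/-- **An endomorphism commuting with every traceless endomorphism is a scalar** (finite-dimensional `V`
over a field): in a basis it commutes with every elementary matrix `E_{kl}`, `k ≠ l` (which is traceless),
hence is a scalar matrix (Mathlib `Matrix.mem_range_scalar_of_commute_single`).
[cite: Katz1990ESDE, §1.8 Prop. 1.8.2 (proof, last paragraph)] -/
theorem exists_eq_smul_id_of_forall_comm_of_trace_eq_zero (C : V →ₗ[K] V)
    (hC : ∀ X : V →ₗ[K] V, LinearMap.trace K V X = 0 → X ∘ₗ C = C ∘ₗ X) :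
    ∃ c : K, C = c • LinearMap.id := by
  classical
  let b := Module.finBasis K V
  set M := LinearMap.toMatrix b b C with hM
  have hcomm : Pairwise fun i j => Commute (Matrix.single i j (1 : K)) M := by
    intro i j hij
    have hX : LinearMap.trace K V (Matrix.toLin b b (Matrix.single i j (1 : K))) = 0 := by
      rw [LinearMap.trace_eq_matrix_trace K b, LinearMap.toMatrix_toLin, Matrix.trace_single_eq_of_ne i j (1 : K) hij]
    have h := congrArg (LinearMap.toMatrix b b) (hC _ hX)
    rw [LinearMap.toMatrix_comp b b b, LinearMap.toMatrix_comp b b b, LinearMap.toMatrix_toLin] at h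
    exact h
  obtain ⟨r, hr⟩ := Matrix.mem_range_scalar_of_commute_single hcomm
  refine ⟨r, (LinearMap.toMatrix b b).injective ?_⟩
  rw [← hM, ← hr, LinearEquiv.map_smul, LinearMap.toMatrix_id, Matrix.scalar_apply, Matrix.smul_one_eq_diagonal]

/-! ### §2 Equivariant conjugation isomorphisms are twists -/

/-- **The twist `ρᵢ ≅ χ ⊗ ρⱼ` from an equivariant `Ad(A)`** (Katz: "`g ↦ AgA⁻¹`"): let `A : V ≅ V'`, `s ∈ GL(V)`,
`s' ∈ GL(V')`, and suppose `A (s X s⁻¹) A⁻¹ = s' (A X A⁻¹) s'⁻¹` for every traceless `X ∈ End(V)`.  Then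
`A ∘ s = c • (s' ∘ A)` for some scalar `c` — `A⁻¹ s'⁻¹ A s` commutes with every traceless `X`.
[cite: Katz1990ESDE, §1.8 Prop. 1.8.2 (proof, last paragraph)] -/
theorem exists_comp_eq_smul_comp_of_conj_equivariant (A : V ≃ₗ[K] V') (s : V ≃ₗ[K] V) (s' : V' ≃ₗ[K] V')
    (h : ∀ X : V →ₗ[K] V, LinearMap.trace K V X = 0 →
      (A : V →ₗ[K] V') ∘ₗ ((s : V →ₗ[K] V) ∘ₗ X ∘ₗ (s.symm : V →ₗ[K] V)) ∘ₗ (A.symm : V' →ₗ[K] V) =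
        (s' : V' →ₗ[K] V') ∘ₗ ((A : V →ₗ[K] V') ∘ₗ X ∘ₗ (A.symm : V' →ₗ[K] V)) ∘ₗ (s'.symm : V' →ₗ[K] V')) :
    ∃ c : K, (A : V →ₗ[K] V') ∘ₗ (s : V →ₗ[K] V) = c • ((s' : V' →ₗ[K] V') ∘ₗ (A : V →ₗ[K] V')) := by
  -- `C = A⁻¹ s'⁻¹ A s` commutes with every traceless `X`
  let C : V →ₗ[K] V :=
    (A.symm : V' →ₗ[K] V) ∘ₗ (s'.symm : V' →ₗ[K] V') ∘ₗ (A : V →ₗ[K] V') ∘ₗ (s : V →ₗ[K] V)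
  have hC : ∀ X : V →ₗ[K] V, LinearMap.trace K V X = 0 → X ∘ₗ C = C ∘ₗ X := by
    intro X hX
    ext x
    -- evaluate the equivariance at `A (s x)` and apply `A⁻¹ s'⁻¹`
    have hx := LinearMap.congr_fun (h X hX) (A (s x))
    simp only [LinearMap.coe_comp, LinearEquiv.coe_coe, Function.comp_apply, LinearEquiv.symm_apply_apply] at hx
    have hx' := congrArg (fun y => A.symm (s'.symm y)) hx
    simp only [LinearEquiv.symm_apply_apply] at hx'
    simp only [C, LinearMap.coe_comp, LinearEquiv.coe_coe, Function.comp_apply]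
    exact hx'.symm
  obtain ⟨c, hc⟩ := exists_eq_smul_id_of_forall_comm_of_trace_eq_zero C hC
  refine ⟨c, ?_⟩
  ext x
  -- `A s x = s' A (C x) = s' A (c x) = c s' A x`
  have hCx : C x = c • x := by rw [hc]; rfl
  have h1 : A (s x) = s' (A (C x)) := by
    simp only [C, LinearMap.coe_comp, LinearEquiv.coe_coe, Function.comp_apply, LinearEquiv.apply_symm_apply]
  rw [LinearMap.comp_apply, LinearEquiv.coe_coe, LinearEquiv.coe_coe, LinearMap.smul_apply, LinearMap.comp_apply,
    LinearEquiv.coe_coe, LinearEquiv.coe_coe, h1, hCx, map_smul, map_smul]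

/-! ### §3 The contragredient version -/

/-- Schur for the traceless commutant, contragredient form: an endomorphism of `V^∨` commuting with the
transpose `X^∨` of every traceless `X ∈ End(V)` is a scalar (transport along `V ≅ V^∨∨`).
[cite: Katz1990ESDE, §1.8 Prop. 1.8.2 (proof, last paragraph)] -/
theorem exists_eq_smul_id_of_forall_comm_dualMap_of_trace_eq_zero (C : Dual K V →ₗ[K] Dual K V)
    (hC : ∀ X : V →ₗ[K] V, LinearMap.trace K V X = 0 → X.dualMap ∘ₗ C = C ∘ₗ X.dualMap) :
    ∃ c : K, C = c • LinearMap.id := by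
  let e : V ≃ₗ[K] Dual K (Dual K V) := evalEquiv K V
  -- naturality of `eval`: `e (X v) = X^∨∨ (e v)`
  have hnat : ∀ (X : V →ₗ[K] V) (v : V), e (X v) = X.dualMap.dualMap (e v) := by
    intro X v
    refine LinearMap.ext fun φ => ?_
    simp only [e, evalEquiv_apply, Dual.eval_apply, LinearMap.dualMap_apply]
  -- `D = e⁻¹ ∘ C^∨ ∘ e` commutes with every traceless `X`
  let D : V →ₗ[K] V := (e.symm : Dual K (Dual K V) →ₗ[K] V) ∘ₗ C.dualMap ∘ₗ (e : V →ₗ[K] Dual K (Dual K V))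
  have hD : ∀ X : V →ₗ[K] V, LinearMap.trace K V X = 0 → X ∘ₗ D = D ∘ₗ X := by
    intro X hX
    have h1 := congrArg LinearMap.dualMap (hC X hX)
    rw [← LinearMap.dualMap_comp_dualMap, ← LinearMap.dualMap_comp_dualMap] at h1
    -- `h1 : C^∨ ∘ X^∨∨ = X^∨∨ ∘ C^∨`
    refine LinearMap.ext fun v => ?_
    simp only [D, LinearMap.coe_comp, LinearEquiv.coe_coe, Function.comp_apply]
    apply e.injective
    rw [hnat, LinearEquiv.apply_symm_apply, LinearEquiv.apply_symm_apply, hnat]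
    exact (LinearMap.congr_fun h1 (e v)).symm
  obtain ⟨c, hc⟩ := exists_eq_smul_id_of_forall_comm_of_trace_eq_zero D hD
  refine ⟨c, LinearMap.ext fun φ => LinearMap.ext fun v => ?_⟩
  -- `D v = c v` reads `C^∨ (e v) = c • e v`; evaluate at `φ`
  have hv : C.dualMap (e v) = c • e v := by
    have h := LinearMap.congr_fun hc v
    simp only [D, LinearMap.coe_comp, LinearEquiv.coe_coe, Function.comp_apply, LinearMap.smul_apply,
      LinearMap.id_apply] at h
    have h' := congrArg e h
    rwa [LinearEquiv.apply_symm_apply, map_smul] at h'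
  have h2 := LinearMap.congr_fun hv φ
  simp only [e, evalEquiv_apply, LinearMap.dualMap_apply, Dual.eval_apply, LinearMap.smul_apply, smul_eq_mul] at h2
  rw [LinearMap.smul_apply, LinearMap.id_apply, LinearMap.smul_apply, smul_eq_mul]
  exact h2

/-- **The twist `ρᵢ^∨ ≅ χ ⊗ ρⱼ` from an equivariant `Ad(A) ∘ (·)^∨`** (Katz: "`g ↦ A g^{−t} A⁻¹`"): let
`A : V^∨ ≅ V'`, `s ∈ GL(V)`, `s' ∈ GL(V')`, and suppose `A (s X s⁻¹)^∨ A⁻¹ = s' (A X^∨ A⁻¹) s'⁻¹` for every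
traceless `X ∈ End(V)` (note `(s X s⁻¹)^∨ = (s⁻¹)^∨ X^∨ s^∨`).  Then `A ∘ (s⁻¹)^∨ = c • (s' ∘ A)` for some
scalar `c` — the shape of hypothesis (4) of `Katz1990_goursatKolchinRibet_specialLinear'` with
`(ρᵢ(s))^∨⁻¹ = (s⁻¹)^∨ = LinearMap.dualMap s.symm`. [cite: Katz1990ESDE, §1.8 Prop. 1.8.2 (proof, last paragraph)] -/
theorem exists_comp_dualMap_eq_smul_comp_of_conj_equivariant (A : Dual K V ≃ₗ[K] V') (s : V ≃ₗ[K] V)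
    (s' : V' ≃ₗ[K] V')
    (h : ∀ X : V →ₗ[K] V, LinearMap.trace K V X = 0 →
      (A : Dual K V →ₗ[K] V') ∘ₗ ((s : V →ₗ[K] V) ∘ₗ X ∘ₗ (s.symm : V →ₗ[K] V)).dualMap ∘ₗ
          (A.symm : V' →ₗ[K] Dual K V) =
        (s' : V' →ₗ[K] V') ∘ₗ ((A : Dual K V →ₗ[K] V') ∘ₗ X.dualMap ∘ₗ (A.symm : V' →ₗ[K] Dual K V)) ∘ₗ
          (s'.symm : V' →ₗ[K] V')) :
    ∃ c : K, (A : Dual K V →ₗ[K] V') ∘ₗ (s.symm : V →ₗ[K] V).dualMap =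
      c • ((s' : V' →ₗ[K] V') ∘ₗ (A : Dual K V →ₗ[K] V')) := by
  -- `C = A⁻¹ s'⁻¹ A (s⁻¹)^∨` commutes with every `X^∨`, `X` traceless
  let C : Dual K V →ₗ[K] Dual K V :=
    (A.symm : V' →ₗ[K] Dual K V) ∘ₗ (s'.symm : V' →ₗ[K] V') ∘ₗ (A : Dual K V →ₗ[K] V') ∘ₗ
      (s.symm : V →ₗ[K] V).dualMap
  -- `(s X s⁻¹)^∨ = (s⁻¹)^∨ ∘ X^∨ ∘ s^∨`, and `s^∨ ∘ (s⁻¹)^∨ = id`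
  have hdual : ∀ X : V →ₗ[K] V, ((s : V →ₗ[K] V) ∘ₗ X ∘ₗ (s.symm : V →ₗ[K] V)).dualMap =
      (s.symm : V →ₗ[K] V).dualMap ∘ₗ X.dualMap ∘ₗ (s : V →ₗ[K] V).dualMap := by
    intro X
    rw [← LinearMap.dualMap_comp_dualMap, ← LinearMap.dualMap_comp_dualMap, LinearMap.comp_assoc]
  have hss : ∀ φ : Dual K V, (s : V →ₗ[K] V).dualMap ((s.symm : V →ₗ[K] V).dualMap φ) = φ := by
    intro φ
    refine LinearMap.ext fun v => ?_
    simp only [LinearMap.dualMap_apply, LinearEquiv.coe_coe, LinearEquiv.symm_apply_apply]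
  have hC : ∀ X : V →ₗ[K] V, LinearMap.trace K V X = 0 → X.dualMap ∘ₗ C = C ∘ₗ X.dualMap := by
    intro X hX
    refine LinearMap.ext fun φ => ?_
    -- evaluate the equivariance at `A ((s⁻¹)^∨ φ)` and apply `A⁻¹ s'⁻¹`
    have hx := LinearMap.congr_fun (h X hX) (A ((s.symm : V →ₗ[K] V).dualMap φ))
    rw [hdual] at hx
    simp only [LinearMap.coe_comp, LinearEquiv.coe_coe, Function.comp_apply, LinearEquiv.symm_apply_apply, hss] at hx
    have hx' := congrArg (fun y => A.symm (s'.symm y)) hx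
    simp only [LinearEquiv.symm_apply_apply] at hx'
    simp only [C, LinearMap.coe_comp, LinearEquiv.coe_coe, Function.comp_apply]
    exact hx'.symm
  obtain ⟨c, hc⟩ := exists_eq_smul_id_of_forall_comm_dualMap_of_trace_eq_zero C hC
  refine ⟨c, LinearMap.ext fun φ => ?_⟩
  have hCφ : C φ = c • φ := by rw [hc]; rfl
  have h1 : A ((s.symm : V →ₗ[K] V).dualMap φ) = s' (A (C φ)) := by
    simp only [C, LinearMap.coe_comp, LinearEquiv.coe_coe, Function.comp_apply, LinearEquiv.apply_symm_apply]
  rw [LinearMap.comp_apply, LinearEquiv.coe_coe, LinearMap.smul_apply, LinearMap.comp_apply, LinearEquiv.coe_coe,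
    LinearEquiv.coe_coe, h1, hCφ, map_smul, map_smul]

end Literature.AlgebraicGeometry.HodgeTheory

end
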